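import Literature.Geometry.Riemannian.HyperboloidDiscreteAction
import Literature.Geometry.Riemannian.RoundSphere
import Literature.Geometry.Manifold.OpenSubmanifoldMFDeriv
import Mathlib.Geometry.Manifold.MFDeriv.NormedSpace
import Mathlib.Geometry.Manifold.ContMDiff.NormedSpace
import Mathlib.Analysis.Calculus.Deriv.Inv
import HarnessLib

/-!
# The hyperbolic cone collar over an immersed unit sphere

Support file for the hardness record of crux `InformationMetricHadamard.AhHadamardFilling`
(item stmt-SmoothPoincare4-6014, line `Sketch`): `SmoothPoincare4 → AhHadamardFilling`, with the
model witness `W = ℍ⁵` (Lee 2018, Thm. 3.7; the route's KILL CRITERIA: "hyperbolic 5-space in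
geodesic polar coordinates is the model witness"). Hyperbolic space is taken in the graph chart of
the hyperboloid model (`Literature.Geometry.Riemannian.Hyperboloid.metric ⊤` on the open submanifold
`⊤ : Opens E5`, components `G_u(w, w) = ‖w‖² - ⟪u, w⟫²/(1 + ‖u‖²)`).

Given a smooth map `f : N → E5 = ℝ⁵` of a manifold `N` into the unit sphere (`‖f x‖ = 1`), the
**cone collar** is `Φ(x, λ) = λ⁻¹ f(x)`, `λ ∈ (0, 1)`, regarded in `⊤ : Opens E5`. We prove the
collar clauses of the crux for it:

* `coneCollar_contMDiffOn`, `coneCollar_injOn` (for `f` injective);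
* `image_coneCollar` — for `f` onto the unit sphere, `Φ(N × (0,t)) = {‖u‖ > 1/t}` (`0 < t ≤ 1`), whence
  the far parts are co-compact (`isCompact_compl_image_coneCollar`) and
  `closure Φ(N × (0,t)) ⊆ Φ(N × (0,1))` (`closure_image_coneCollar_subset`);
* `mfderiv_coneCollar_apply` — `dΦ_{(x,λ)}(v, s) = λ⁻¹ df_x v - (s/λ²) f(x)`;
* `metric_coneCollar_eq` — the EXACT identity
  `G_{Φ(x,λ)}(dΦ(v,s), dΦ(v,s)) = ‖df_x v‖²/λ² + s²/(λ²(λ²+1))` (using `⟪f x, df_x v⟫ = 0`,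
  `inner_mfderiv_eq_zero_of_norm_eq_one`), so that with `c = 1` and `g = f^*⟪·,·⟫` the model
  `c (s² + g(v,v))/λ²` is missed by exactly `s²/(λ²+1) ≤ λ² · (s² + g(v,v))/λ²`:
* `coneCollar_asymptotics` — the `C⁰` cone asymptotics clause of the crux with `c = 1`, `t = √ε ⊓ ½`.

Pure calculus over existing definitions; no definitions of its own besides the abbreviation-free
lambda `fun p ↦ ⟨(p.2)⁻¹ • f p.1, trivial⟩`, no named facts.
-/

noncomputable section

open Bundle Set TopologicalSpace Function Metric
open scoped Manifold ContDiff Topology RealInnerProductSpace NNReal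

namespace Summit.SmoothPoincare4.SmoothPoincare4.Theorems.AhHadamardFilling.Negative

open Literature.Geometry.Riemannian Literature.Geometry.Riemannian.Hyperboloid
open Literature.Geometry.Lorentzian Literature.Geometry.Lorentzian.PseudoRiemannianMetric

-- the prescribed namespace `Summit.<P>.<Sub>.…` duplicates `SmoothPoincare4` (P = Sub)
set_option linter.dupNamespace false
-- instance search through the nested operator type `(EuclideanSpace ℝ (Fin 5)) →L[ℝ] (EuclideanSpace ℝ (Fin 5)) →L[ℝ] ℝ` of the metric components
set_option maxSynthPendingDepth 3

variable {N : Type}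

/-! ### The cone map into `E5` and its derivative -/

section ConeMap

variable [TopologicalSpace N] [ChartedSpace (EuclideanSpace ℝ (Fin 4)) N] (f : N → (EuclideanSpace ℝ (Fin 5)))

/-- Tangency: a map into the unit sphere has `⟪f x, df_x v⟫ = 0` (differentiate `‖f‖² = 1`).
[folklore] -/
theorem inner_mfderiv_eq_zero_of_norm_eq_one [IsManifold (𝓡 4) ∞ N]
    (hf : ContMDiff (𝓡 4) (𝓡 5) ∞ f) (h1 : ∀ x, ‖f x‖ = 1) (x : N) (v : TangentSpace (𝓡 4) x) :
    ⟪f x, (mfderiv (𝓡 4) (𝓡 5) f x v : (EuclideanSpace ℝ (Fin 5)))⟫ = 0 := by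
  have hfd : MDifferentiableAt (𝓡 4) (𝓡 5) f x := (hf x).mdifferentiableAt (by simp)
  -- `z ↦ ‖f z‖²` is constant, so its differential vanishes
  have hsq : HasMFDerivAt (𝓡 4) 𝓘(ℝ, ℝ) (fun z : N ↦ ‖f z‖ ^ 2) x
      ((2 • (innerSL ℝ (f x) : (EuclideanSpace ℝ (Fin 5)) →L[ℝ] ℝ)).comp (mfderiv (𝓡 4) (𝓡 5) f x)) :=
    (hasStrictFDerivAt_norm_sq (f x)).hasFDerivAt.hasMFDerivAt.comp x hfd.hasMFDerivAt
  have hconst : (fun z : N ↦ ‖f z‖ ^ 2) = fun _ ↦ (1 : ℝ) := by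
    funext z; rw [h1 z, one_pow]
  have hzero : HasMFDerivAt (𝓡 4) 𝓘(ℝ, ℝ) (fun z : N ↦ ‖f z‖ ^ 2) x
      (0 : TangentSpace (𝓡 4) x →L[ℝ] ℝ) := by
    rw [hconst]
    exact hasMFDerivAt_const (I := 𝓡 4) (I' := 𝓘(ℝ, ℝ)) (1 : ℝ) x
  have heq := hsq.mfderiv.symm.trans hzero.mfderiv
  have key : ((2 • (innerSL ℝ (f x) : (EuclideanSpace ℝ (Fin 5)) →L[ℝ] ℝ)).comp (mfderiv (𝓡 4) (𝓡 5) f x)) v = 0 := by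
    rw [heq]; rfl
  rw [ContinuousLinearMap.comp_apply, FunLike.coe_smul, Pi.smul_apply, innerSL_apply_apply] at key
  exact (smul_eq_zero.1 key).resolve_left two_ne_zero

variable {f}

/-- The cone map `(x, λ) ↦ λ⁻¹ f(x)` is `C^∞` at every point with `λ ≠ 0`. [folklore] -/
theorem contMDiffAt_coneMap (hf : ContMDiff (𝓡 4) (𝓡 5) ∞ f) {p : N × ℝ} (hp : p.2 ≠ 0) :
    ContMDiffAt ((𝓡 4).prod 𝓘(ℝ, ℝ)) (𝓡 5) ∞ (fun q : N × ℝ ↦ (q.2)⁻¹ • f q.1) p := by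
  have h1 : ContMDiffAt ((𝓡 4).prod 𝓘(ℝ, ℝ)) 𝓘(ℝ, ℝ) ∞ (fun q : N × ℝ ↦ (q.2)⁻¹) p :=
    ((contDiffAt_inv ℝ hp).contMDiffAt).comp p contMDiffAt_snd
  have h2 : ContMDiffAt ((𝓡 4).prod 𝓘(ℝ, ℝ)) (𝓡 5) ∞ (fun q : N × ℝ ↦ f q.1) p :=
    (hf p.1).comp p contMDiffAt_fst
  exact h1.smul h2

/-- **The differential of the cone map**: `d(λ⁻¹ f)_{(x,λ)}(v, s) = λ⁻¹ df_x v - (s/λ²) f(x)`.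
[folklore] -/
theorem mfderiv_coneMap_apply [IsManifold (𝓡 4) ∞ N] (hf : ContMDiff (𝓡 4) (𝓡 5) ∞ f)
    (x : N) {l : ℝ} (hl : l ≠ 0) (v : TangentSpace (𝓡 4) x) (s : ℝ) :
    mfderiv ((𝓡 4).prod 𝓘(ℝ, ℝ)) (𝓡 5) (fun q : N × ℝ ↦ (q.2)⁻¹ • f q.1) (x, l) (v, s) =
      l⁻¹ • (id (mfderiv (𝓡 4) (𝓡 5) f x v) : (EuclideanSpace ℝ (Fin 5))) + (-(s * (l ^ 2)⁻¹)) • f x := by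
  have hΦd : MDifferentiableAt ((𝓡 4).prod 𝓘(ℝ, ℝ)) (𝓡 5)
      (fun q : N × ℝ ↦ (q.2)⁻¹ • f q.1) (x, l) :=
    (contMDiffAt_coneMap hf (p := (x, l)) hl).mdifferentiableAt (by simp)
  rw [mfderiv_prod_eq_add_apply hΦd]
  have hfd : MDifferentiableAt (𝓡 4) (𝓡 5) f x := (hf x).mdifferentiableAt (by simp)
  -- the `x`-partial: `z ↦ l⁻¹ • f z`
  have hA : mfderiv (𝓡 4) (𝓡 5) (fun z : N ↦ l⁻¹ • f z) x v =
      l⁻¹ • (mfderiv (𝓡 4) (𝓡 5) f x v : (EuclideanSpace ℝ (Fin 5))) := by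
    have := const_smul_mfderiv hfd l⁻¹
    rw [show (l⁻¹ • f : N → (EuclideanSpace ℝ (Fin 5))) = fun z ↦ l⁻¹ • f z from rfl] at this
    rw [this]
    rfl
  -- the `λ`-partial: `z ↦ z⁻¹ • f x`
  have hB : mfderiv 𝓘(ℝ, ℝ) (𝓡 5) (fun z : ℝ ↦ z⁻¹ • f x) l s = (-(s * (l ^ 2)⁻¹)) • f x := by
    have hd : HasDerivAt (fun z : ℝ ↦ z⁻¹ • f x) ((-(l ^ 2)⁻¹) • f x) l :=
      (hasDerivAt_inv hl).smul_const (f x)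
    rw [mfderiv_eq_fderiv, hd.hasFDerivAt.fderiv]
    show s • ((-(l ^ 2)⁻¹) • f x) = (-(s * (l ^ 2)⁻¹)) • f x
    rw [smul_smul]
    congr 1
    ring
  show mfderiv (𝓡 4) (𝓡 5) (fun z : N ↦ l⁻¹ • f z) x v +
      mfderiv 𝓘(ℝ, ℝ) (𝓡 5) (fun z : ℝ ↦ z⁻¹ • f x) l s = _
  rw [hA, hB]
  rfl

end ConeMap

/-! ### The cone collar in the open submanifold `⊤ : Opens E5` -/

section CollarSet

variable (f : N → (EuclideanSpace ℝ (Fin 5)))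

/-- The cone collar is injective on `N × (0, ∞)` when `f` is injective into the unit sphere.
[folklore] -/
theorem coneCollar_injOn (hinj : Injective f) (h1 : ∀ x, ‖f x‖ = 1) :
    InjOn (fun p : N × ℝ ↦ (⟨(p.2)⁻¹ • f p.1, trivial⟩ : (⊤ : Opens (EuclideanSpace ℝ (Fin 5))))) (univ ×ˢ Ioo (0 : ℝ) 1) := by
  rintro ⟨x, l⟩ hx ⟨x', l'⟩ hx' h
  have hl : 0 < l := hx.2.1
  have hl' : 0 < l' := hx'.2.1
  have h' : l⁻¹ • f x = l'⁻¹ • f x' := congrArg Subtype.val h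
  have hn := congrArg (fun u : (EuclideanSpace ℝ (Fin 5)) ↦ ‖u‖) h'
  simp only [norm_smul, norm_inv, Real.norm_eq_abs, abs_of_pos hl, abs_of_pos hl', h1,
    mul_one] at hn
  have hll : l = l' := inv_injective hn
  subst hll
  have hfx : f x = f x' := smul_right_injective (EuclideanSpace ℝ (Fin 5)) (inv_ne_zero hl.ne') h'
  rw [hinj hfx]

/-- **The far parts of the cone collar**: for `f` onto the unit sphere and `0 < t`,
`Φ(N × (0,t)) = {u | 1/t < ‖u‖}`. [folklore] -/
theorem image_coneCollar (h1 : ∀ x, ‖f x‖ = 1)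
    (hsurj : ∀ y : (EuclideanSpace ℝ (Fin 5)), ‖y‖ = 1 → y ∈ range f) {t : ℝ} (ht : 0 < t) :
    (fun p : N × ℝ ↦ (⟨(p.2)⁻¹ • f p.1, trivial⟩ : (⊤ : Opens (EuclideanSpace ℝ (Fin 5))))) '' (univ ×ˢ Ioo (0 : ℝ) t) =
      {u : (⊤ : Opens (EuclideanSpace ℝ (Fin 5))) | t⁻¹ < ‖(u : (EuclideanSpace ℝ (Fin 5)))‖} := by
  ext u
  simp only [mem_image, mem_prod, mem_univ, true_and, mem_Ioo, mem_setOf_eq, Prod.exists]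
  constructor
  · rintro ⟨x, l, ⟨hl0, hlt⟩, rfl⟩
    simp only [norm_smul, norm_inv, Real.norm_eq_abs, abs_of_pos hl0, h1, mul_one]
    exact (inv_lt_inv₀ ht hl0).2 hlt
  · intro hu
    have hu0 : 0 < ‖(u : (EuclideanSpace ℝ (Fin 5)))‖ := lt_trans (inv_pos.2 ht) hu
    obtain ⟨x, hx⟩ := hsurj (‖(u : (EuclideanSpace ℝ (Fin 5)))‖⁻¹ • (u : (EuclideanSpace ℝ (Fin 5))))
      (by rw [norm_smul, norm_inv, norm_norm, inv_mul_cancel₀ hu0.ne'])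
    refine ⟨x, ‖(u : (EuclideanSpace ℝ (Fin 5)))‖⁻¹, ⟨inv_pos.2 hu0, ?_⟩, ?_⟩
    · rwa [inv_lt_comm₀ hu0 ht]
    · apply Subtype.ext
      simp only [inv_inv, hx, smul_smul, mul_inv_cancel₀ hu0.ne', one_smul]

/-- The far parts are co-compact: `(Φ(N × (0,t)))ᶜ = {‖u‖ ≤ 1/t}` is a closed Euclidean ball.
[folklore] -/
theorem isCompact_compl_image_coneCollar (h1 : ∀ x, ‖f x‖ = 1)
    (hsurj : ∀ y : (EuclideanSpace ℝ (Fin 5)), ‖y‖ = 1 → y ∈ range f) {t : ℝ} (ht : t ∈ Ioo (0 : ℝ) 1) :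
    IsCompact ((fun p : N × ℝ ↦ (⟨(p.2)⁻¹ • f p.1, trivial⟩ : (⊤ : Opens (EuclideanSpace ℝ (Fin 5))))) ''
      (univ ×ˢ Ioo (0 : ℝ) t))ᶜ := by
  rw [image_coneCollar f h1 hsurj ht.1]
  have : {u : (⊤ : Opens (EuclideanSpace ℝ (Fin 5))) | t⁻¹ < ‖(u : (EuclideanSpace ℝ (Fin 5)))‖}ᶜ = topHomeomorph ⁻¹' closedBall (0 : (EuclideanSpace ℝ (Fin 5))) t⁻¹ := by
    ext u
    simp [topHomeomorph, not_lt]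
  rw [this]
  exact (topHomeomorph (V := (EuclideanSpace ℝ (Fin 5)))).isCompact_preimage.2 (isCompact_closedBall _ _)

/-- The closure clause: `closure Φ(N × (0,t)) ⊆ {‖u‖ ≥ 1/t} ⊆ {‖u‖ > 1} = Φ(N × (0,1))` for
`0 < t < 1`. [folklore] -/
theorem closure_image_coneCollar_subset (h1 : ∀ x, ‖f x‖ = 1)
    (hsurj : ∀ y : (EuclideanSpace ℝ (Fin 5)), ‖y‖ = 1 → y ∈ range f) {t : ℝ} (ht : t ∈ Ioo (0 : ℝ) 1) :
    closure ((fun p : N × ℝ ↦ (⟨(p.2)⁻¹ • f p.1, trivial⟩ : (⊤ : Opens (EuclideanSpace ℝ (Fin 5))))) ''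
        (univ ×ˢ Ioo (0 : ℝ) t)) ⊆
      (fun p : N × ℝ ↦ (⟨(p.2)⁻¹ • f p.1, trivial⟩ : (⊤ : Opens (EuclideanSpace ℝ (Fin 5))))) '' (univ ×ˢ Ioo (0 : ℝ) 1) := by
  rw [image_coneCollar f h1 hsurj ht.1, image_coneCollar f h1 hsurj one_pos, inv_one]
  have hcl : IsClosed {u : (⊤ : Opens (EuclideanSpace ℝ (Fin 5))) | t⁻¹ ≤ ‖(u : (EuclideanSpace ℝ (Fin 5)))‖} :=
    isClosed_le continuous_const (continuous_norm.comp continuous_subtype_val)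
  have hsub : {u : (⊤ : Opens (EuclideanSpace ℝ (Fin 5))) | t⁻¹ < ‖(u : (EuclideanSpace ℝ (Fin 5)))‖} ⊆ {u : (⊤ : Opens (EuclideanSpace ℝ (Fin 5))) | t⁻¹ ≤ ‖(u : (EuclideanSpace ℝ (Fin 5)))‖} :=
    fun u hu ↦ show t⁻¹ ≤ ‖(u : (EuclideanSpace ℝ (Fin 5)))‖ from le_of_lt hu
  refine (closure_minimal hsub hcl).trans fun u hu ↦ ?_
  exact lt_of_lt_of_le ((one_lt_inv₀ ht.1).2 ht.2) hu

end CollarSet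

section Collar

variable [TopologicalSpace N] [ChartedSpace (EuclideanSpace ℝ (Fin 4)) N] (f : N → (EuclideanSpace ℝ (Fin 5)))

/-- `C^∞` on `N × (ℝ ∖ {0})`, hence on `N × (0,1)`: the cone collar `Φ(x,λ) = λ⁻¹ f(x)` in
`⊤ : Opens E5`. [folklore] -/
theorem coneCollar_contMDiffOn (hf : ContMDiff (𝓡 4) (𝓡 5) ∞ f) :
    ContMDiffOn ((𝓡 4).prod 𝓘(ℝ, ℝ)) (𝓡 5) ∞
      (fun p : N × ℝ ↦ (⟨(p.2)⁻¹ • f p.1, trivial⟩ : (⊤ : Opens (EuclideanSpace ℝ (Fin 5))))) (univ ×ˢ Ioo (0 : ℝ) 1) := by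
  intro p hp
  have hp2 : p.2 ≠ 0 := (ne_of_gt hp.2.1)
  refine ContMDiffAt.contMDiffWithinAt ?_
  rw [← ContMDiffAt.subtypeVal_comp_iff]
  exact contMDiffAt_coneMap hf hp2

/-- **The differential of the cone collar** in `⊤ : Opens E5` is that of the cone map:
`dΦ_{(x,λ)}(v, s) = λ⁻¹ df_x v - (s/λ²) f(x)` (the inclusion of the open submanifold has identity
differential). [folklore] -/
theorem mfderiv_coneCollar_apply [IsManifold (𝓡 4) ∞ N] (hf : ContMDiff (𝓡 4) (𝓡 5) ∞ f)
    (x : N) {l : ℝ} (hl : l ≠ 0) (v : TangentSpace (𝓡 4) x) (s : ℝ) :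
    mfderiv ((𝓡 4).prod 𝓘(ℝ, ℝ)) (𝓡 5)
        (fun p : N × ℝ ↦ (⟨(p.2)⁻¹ • f p.1, trivial⟩ : (⊤ : Opens (EuclideanSpace ℝ (Fin 5))))) (x, l) (v, s) =
      l⁻¹ • (id (mfderiv (𝓡 4) (𝓡 5) f x v) : (EuclideanSpace ℝ (Fin 5))) + (-(s * (l ^ 2)⁻¹)) • f x := by
  set Φ : N × ℝ → (⊤ : Opens (EuclideanSpace ℝ (Fin 5))) := fun p ↦ ⟨(p.2)⁻¹ • f p.1, trivial⟩ with hΦ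
  have hΦ0 : ContMDiffAt ((𝓡 4).prod 𝓘(ℝ, ℝ)) (𝓡 5) ∞ Φ (x, l) := by
    rw [← ContMDiffAt.subtypeVal_comp_iff]
    exact contMDiffAt_coneMap hf (p := (x, l)) hl
  have hΦd : MDifferentiableAt ((𝓡 4).prod 𝓘(ℝ, ℝ)) (𝓡 5) Φ (x, l) :=
    hΦ0.mdifferentiableAt (by simp)
  have hA : HasMFDerivAt ((𝓡 4).prod 𝓘(ℝ, ℝ)) (𝓡 5) (Subtype.val ∘ Φ) (x, l)
      ((ContinuousLinearMap.id ℝ (EuclideanSpace ℝ (Fin 5))).comp (mfderiv ((𝓡 4).prod 𝓘(ℝ, ℝ)) (𝓡 5) Φ (x, l))) :=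
    (Literature.Geometry.Manifold.OpenSubmanifold.hasMFDerivAt_subtype_val _).comp (x, l)
      hΦd.hasMFDerivAt
  have hcone : MDifferentiableAt ((𝓡 4).prod 𝓘(ℝ, ℝ)) (𝓡 5)
      (fun q : N × ℝ ↦ (q.2)⁻¹ • f q.1) (x, l) :=
    (contMDiffAt_coneMap hf (p := (x, l)) hl).mdifferentiableAt (by simp)
  have hB : HasMFDerivAt ((𝓡 4).prod 𝓘(ℝ, ℝ)) (𝓡 5) (Subtype.val ∘ Φ) (x, l)
      (mfderiv ((𝓡 4).prod 𝓘(ℝ, ℝ)) (𝓡 5) (fun q : N × ℝ ↦ (q.2)⁻¹ • f q.1) (x, l)) :=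
    hcone.hasMFDerivAt
  have heq := hA.mfderiv.symm.trans hB.mfderiv
  exact (DFunLike.congr_fun heq (v, s)).trans (mfderiv_coneMap_apply hf x hl v s)

end Collar

/-! ### The metric identity and the `C⁰` cone asymptotics -/

section Asymptotics

/-- **Algebra of the hyperbolic cone**: for a unit vector `y ⟂ D` and `λ ≠ 0`,
`G_{λ⁻¹ y}(λ⁻¹ D - (s/λ²) y, λ⁻¹ D - (s/λ²) y) = ‖D‖²/λ² + s²/(λ²(λ²+1))`, where
`G_u(w,w) = ‖w‖² - ⟪u,w⟫²/(1+‖u‖²)` are the hyperbolic metric components. [folklore] -/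
theorem comp_cone_eq (y D : (EuclideanSpace ℝ (Fin 5))) (hy : ‖y‖ = 1) (hyD : ⟪y, D⟫ = 0) {l : ℝ} (hl : l ≠ 0) (s : ℝ) :
    comp (l⁻¹ • y) (l⁻¹ • D + (-(s * (l ^ 2)⁻¹)) • y) (l⁻¹ • D + (-(s * (l ^ 2)⁻¹)) • y) =
      ‖D‖ ^ 2 / l ^ 2 + s ^ 2 / (l ^ 2 * (l ^ 2 + 1)) := by
  have hyy : ⟪y, y⟫ = 1 := by rw [real_inner_self_eq_norm_sq, hy, one_pow]
  have hDy : ⟪D, y⟫ = 0 := by rw [real_inner_comm]; exact hyD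
  have hw : weight (l⁻¹ • y) = l ^ 2 / (l ^ 2 + 1) := by
    rw [weight, norm_smul, norm_inv, Real.norm_eq_abs, hy, mul_one, inv_pow, sq_abs]
    field_simp
  rw [Hyperboloid.comp_apply, hw]
  simp only [inner_add_left, inner_add_right, inner_smul_left, inner_smul_right, hyy, hyD, hDy,
    real_inner_self_eq_norm_sq, RCLike.conj_to_real]
  field_simp
  ring

/-- **The error bound**: with `a = ‖df v‖² ≥ 0`, `0 < λ` and `λ² ≤ ε`,
`|a/λ² + s²/(λ²(λ²+1)) - (s² + a)/λ²| = s²/(λ²+1) ≤ ε (s² + a)/λ²`. [folklore] -/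
theorem cone_error_le {a s l ε : ℝ} (ha : 0 ≤ a) (hl : 0 < l) (hle : l ^ 2 ≤ ε) :
    |a / l ^ 2 + s ^ 2 / (l ^ 2 * (l ^ 2 + 1)) - 1 * (s ^ 2 + a) / l ^ 2| ≤
      ε * (1 * (s ^ 2 + a) / l ^ 2) := by
  have hl2 : 0 < l ^ 2 := by positivity
  have hl21 : 0 < l ^ 2 + 1 := by positivity
  have hid : a / l ^ 2 + s ^ 2 / (l ^ 2 * (l ^ 2 + 1)) - 1 * (s ^ 2 + a) / l ^ 2 =
      -(s ^ 2 / (l ^ 2 + 1)) := by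
    field_simp
    ring
  rw [hid, abs_neg, abs_of_nonneg (by positivity)]
  -- `s²/(l²+1) ≤ s² ≤ ε s²/l² ≤ ε (s² + a)/l²`
  have h1 : s ^ 2 / (l ^ 2 + 1) ≤ s ^ 2 := div_le_self (sq_nonneg s) (by linarith)
  have h2 : s ^ 2 ≤ ε * (s ^ 2 / l ^ 2) := by
    rw [← mul_div_assoc, le_div_iff₀ hl2]
    nlinarith [sq_nonneg s]
  have h3 : ε * (s ^ 2 / l ^ 2) ≤ ε * (1 * (s ^ 2 + a) / l ^ 2) := by
    have hε : 0 ≤ ε := hl2.le.trans hle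
    apply mul_le_mul_of_nonneg_left _ hε
    rw [one_mul]
    exact div_le_div_of_nonneg_right (by linarith) hl2.le
  linarith

variable [TopologicalSpace N] [ChartedSpace (EuclideanSpace ℝ (Fin 4)) N] (f : N → (EuclideanSpace ℝ (Fin 5)))

/-- **The exact metric identity on the cone collar**: for `f` into the unit sphere,
`G_{Φ(x,λ)}(dΦ(v,s), dΦ(v,s)) = ‖df_x v‖²/λ² + s²/(λ²(λ²+1))`, `G` the hyperbolic metric
`Hyperboloid.metric ⊤`. [folklore] -/
theorem metric_coneCollar_eq [IsManifold (𝓡 4) ∞ N] (hf : ContMDiff (𝓡 4) (𝓡 5) ∞ f)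
    (h1 : ∀ x, ‖f x‖ = 1) (x : N) {l : ℝ} (hl : l ≠ 0) (v : TangentSpace (𝓡 4) x) (s : ℝ) :
    (metric (⊤ : Opens (EuclideanSpace ℝ (Fin 5)))).val
        ((fun p : N × ℝ ↦ (⟨(p.2)⁻¹ • f p.1, trivial⟩ : (⊤ : Opens (EuclideanSpace ℝ (Fin 5))))) (x, l))
        (mfderiv ((𝓡 4).prod 𝓘(ℝ, ℝ)) (𝓡 5)
          (fun p : N × ℝ ↦ (⟨(p.2)⁻¹ • f p.1, trivial⟩ : (⊤ : Opens (EuclideanSpace ℝ (Fin 5))))) (x, l) (v, s))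
        (mfderiv ((𝓡 4).prod 𝓘(ℝ, ℝ)) (𝓡 5)
          (fun p : N × ℝ ↦ (⟨(p.2)⁻¹ • f p.1, trivial⟩ : (⊤ : Opens (EuclideanSpace ℝ (Fin 5))))) (x, l) (v, s)) =
      ‖(id (mfderiv (𝓡 4) (𝓡 5) f x v) : (EuclideanSpace ℝ (Fin 5)))‖ ^ 2 / l ^ 2 + s ^ 2 / (l ^ 2 * (l ^ 2 + 1)) := by
  rw [metric_val]
  have hd := mfderiv_coneCollar_apply f hf x hl v s
  rw [hd]
  exact comp_cone_eq (f x) (mfderiv (𝓡 4) (𝓡 5) f x v) (h1 x)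
    (inner_mfderiv_eq_zero_of_norm_eq_one f hf h1 x v) hl s

/-- **`C⁰` cone asymptotics of the hyperbolic cone collar** (the asymptotics clause of
`AhHadamardFilling` with `c = 1` and `g(v, v) = ‖df v‖²`): for every `ε > 0` there is
`t ∈ (0,1)` (namely `t = √ε ⊓ ½`) such that for `λ ∈ (0, t)`,
`|G(dΦ(v,s), dΦ(v,s)) - (s² + ‖df v‖²)/λ²| ≤ ε (s² + ‖df v‖²)/λ²`. [folklore] -/
theorem coneCollar_asymptotics [IsManifold (𝓡 4) ∞ N] (hf : ContMDiff (𝓡 4) (𝓡 5) ∞ f)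
    (h1 : ∀ x, ‖f x‖ = 1) (ε : ℝ) (hε : 0 < ε) :
    ∃ t ∈ Ioo (0 : ℝ) 1, ∀ (x : N) (l : ℝ), l ∈ Ioo (0 : ℝ) t →
      ∀ (v : TangentSpace (𝓡 4) x) (s : ℝ),
        |(metric (⊤ : Opens (EuclideanSpace ℝ (Fin 5)))).val
            ((fun p : N × ℝ ↦ (⟨(p.2)⁻¹ • f p.1, trivial⟩ : (⊤ : Opens (EuclideanSpace ℝ (Fin 5))))) (x, l))
            (mfderiv ((𝓡 4).prod 𝓘(ℝ, ℝ)) (𝓡 5)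
              (fun p : N × ℝ ↦ (⟨(p.2)⁻¹ • f p.1, trivial⟩ : (⊤ : Opens (EuclideanSpace ℝ (Fin 5))))) (x, l) (v, s))
            (mfderiv ((𝓡 4).prod 𝓘(ℝ, ℝ)) (𝓡 5)
              (fun p : N × ℝ ↦ (⟨(p.2)⁻¹ • f p.1, trivial⟩ : (⊤ : Opens (EuclideanSpace ℝ (Fin 5))))) (x, l) (v, s)) -
          1 * (s ^ 2 + ‖(id (mfderiv (𝓡 4) (𝓡 5) f x v) : (EuclideanSpace ℝ (Fin 5)))‖ ^ 2) / l ^ 2| ≤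
        ε * (1 * (s ^ 2 + ‖(id (mfderiv (𝓡 4) (𝓡 5) f x v) : (EuclideanSpace ℝ (Fin 5)))‖ ^ 2) / l ^ 2) := by
  refine ⟨min (Real.sqrt ε) (1 / 2), ⟨lt_min (Real.sqrt_pos.2 hε) (by norm_num),
    (min_le_right _ _).trans_lt (by norm_num)⟩, ?_⟩
  intro x l hl v s
  have hl0 : 0 < l := hl.1
  have hlε : l ^ 2 ≤ ε := by
    have hls : l ≤ Real.sqrt ε := hl.2.le.trans (min_le_left _ _)
    calc l ^ 2 ≤ Real.sqrt ε ^ 2 := pow_le_pow_left₀ hl0.le hls 2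
      _ = ε := Real.sq_sqrt hε.le
  rw [metric_coneCollar_eq f hf h1 x hl0.ne' v s]
  exact cone_error_le (sq_nonneg _) hl0 hlε

end Asymptotics

end Summit.SmoothPoincare4.SmoothPoincare4.Theorems.AhHadamardFilling.Negative

end
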